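import Summits.BirchSwinnertonDyer.BirchSwinnertonDyer.Theorems.KimAtThreeDeepLowerOffStratumNonAdditiveRows
import Summits.BirchSwinnertonDyer.BirchSwinnertonDyer.Theorems.KimAtThreeDeepLowerTamagawaLevelLowering
import Summits.BirchSwinnertonDyer.Rank1Residual.Partition.CornersThreeSemistable
import HarnessLib

/-!
# Route `KimAtThreeKolyvagin` (rung W2), crux `DeepLowerAtThreeOffKatoStratum` (item 19679), registered
# stub `stub_nonAdditive` on its SEMISTABLE rows: (ram) is a theorem there (Ribet to level one), so the
# lower half of `BSD₃` needs no (ram) and no Yan–Zhu binder, the multiplicative-`3`-without-(ram) rows are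
# EMPTY, and the stub is row C1 + Tamagawa divisibility

Cell `bsd-addord`, seat `bsd-addord-w2-acc2` (PROGRAMME PART 1b, ACCEL-LIST row (2)), gen 2; item
`stmt-BirchSwinnertonDyer-19679` (BC3 skeleton `DeepLowerAtThreeOffKatoStratum_birth.lean`, sha16
`e575d03075635394`; the owner w2-c2 assembles via `DeepLowerAtThreeOffKatoStratum_of`). Sequel to gen 0's
`KimAtThreeDeepLowerOffStratumSockets` / `…NonAdditiveRows` / `…Wuthrich` (p455574 / p456155 / p456851) and
to the owner's level-lowering bridge `KimAtThreeDeepLowerTamagawaLevelLowering` (p459466). Theorems only;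
every printed input is a hypothesis BY NAME; residual families are DISPLAYED; nothing asserted; the crux
stays OPEN; BSD is not proved by any of this.

Gen 0 typed the residue of `stub_nonAdditive` (tower rows of analytic rank `0`, `¬ Addv W₀ 3`) as
(L) Miller's lower half `MissingLowerBoundAt W 3` on the rows that are good SUPERSINGULAR at `3` or
multiplicative at `3` WITHOUT Skinner's (ram) witness, and (TD) `v₃(∏ c_ℓ) ≤ ∂^{(∞)}_{deep}(δ̃)` on the
`3 ∣ ∏ c_ℓ` rows. This file uses two tree THEOREMS to shrink (L):

* `Literature.NumberTheory.EllipticCurves.ram_three_of_semistable_of_irr` (rmap-3 gen 4; Ribet 1990 Thm. 1.1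
  + Diamond 1995 as the named fact `diamond1995_refinedSerre`, Modularity `exists_isNewformOf`, Serre's
  weight bound `k(ρ̄) ≤ 8 < 12`, `S_k(SL₂(ℤ)) = 0`): a SEMISTABLE curve with `E[3]` irreducible HAS a prime
  `ℓ ‖ N`, `ℓ ≠ 3`, with `3 ∤ ord_ℓ Δ` — so (ram) is AUTOMATIC on every semistable tower row, whatever the
  reduction at `3` (Cremona `N < 5·10⁵`: 298 932 / 298 932 semistable pairs `(E,3)` with `3 ‖ N`, `E[3]`
  irreducible carry a witness; `Partition/CornersThreeSemistable.lean`);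
* hence on semistable rows the multiplicative-`3`-without-(ram) population is EMPTY
  (`Rank1Residual.not_classX11a_three_of_semistable`) and the good-ordinary rows are row C1 as well as C16.

What is here:
* §1 `missingLowerBoundAt_three_of_semistable_of_skinner` — SEMISTABLE, analytic rank `0`, `E[3]`
  irreducible, `3` not supersingular ⟹ Miller's lower half from FIVE named facts (Skinner 2016 Thm. C `hSk`
  — one socket for good-ordinary-(ram) and multiplicative-(ram) —, `hmod`, GZK, Modularity `hBCDT`,
  level-lowering `hLL`): NO (ram) binder, NO Yan–Zhu binder (flag-free); its numbered-theorems twin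
  `…_of_semistable_of_mainConjectures_of_mazur` (Skinner–Urban 3.6.9 + Skinner Thm. A + Greenberg 4.1 +
  Stein–Wuthrich 6.1 + Greenberg–Stevens + Mazur Cor. 4.1 + modularity, gen 0's row-C1 socket).
* §2 ★ `stub_nonAdditive_semistable_of_skinner_of_tamagawa_le_deepInfty` — the registered stub's binders
  VERBATIM, then `Semistable W₀`, «ordinary if good», and (TD) asked only when `3 ∣ ∏ c_ℓ`; OUTRIGHT on
  `3 ∤ ∏ c_ℓ` (`…_of_not_three_dvd_tamagawa`); and with (TD) DISCHARGED by the owner's stabilised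
  level-lowering congruence (LL_m) on the rows with `v₃(∏ c_ℓ) ≤ m`
  (`…_of_stabilisedCongruence`, via `tamagawa_le_kuriharaPartialInfty_of_stabilisedCongruence`).
* §3 `tamagawa_le_deepInfty_of_stubRow_semistable` — necessity: on the semistable non-supersingular rows the
  stub's row conclusion IMPLIES (TD) (`BSD(E,3)` by name, (ram) automatic), so there the stub ⟺ (TD).
The companion file `KimAtThreeDeepLowerOffStratumResidue` (same session) restates the WHOLE stub VERBATIM
with gen 0's family (L) shrunk to (L_ss) good-SUPERSINGULAR-`3` rows ∪ (L_m) NON-SEMISTABLE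
multiplicative-`3` rows without (ram).
RESIDUE OF THE STUB on the semistable rows, typed: the lower half on the good-SUPERSINGULAR-`3` rows (the
X6 ∪ X8 rank-`0` corner; Kobayashi 2003 / Wuthrich 2014 Prop. 21 print only the upper half; BSTW
arXiv:2409.01350 announced, Sprung 2024 conditional — no `_OPEN` input is taken) and (TD) on `3 ∣ ∏ c_ℓ`. [cite: Ribet1990, Thm. 1.1] [cite: Diamond1995RefinedSerre, Thm. 1.1]
[cite: Skinner2016PacificMC, Thm. C (§1), Thm. A] [cite: SkinnerUrban2014, Thm. 3.6.9 (p. 45), remark before Cor. 3.6.10]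
[cite: GreenbergLNM1716, Thm. 4.1 (p. 102)] [cite: Mazur1978, Cor. 4.1] [cite: YanZhu2024MainConjNonCM, Thm. 4.15 (§4.6)]
[cite: Wuthrich2014, Lemma 20 (p. 399), Prop. 21 (p. 400)] [cite: Miller2011LMS, Def. 1.1]
[cite: Kim2022StructureSelmer, §1.5.1, Conj. 1.10 (PDF pp. 7–8)] [cite: Kim2025RefinedTNC, §8.1.2]
-/


set_option autoImplicit false
-- the Theorems namespace of a single-conjunct summit repeats the summit name by design (D-0017)
set_option linter.dupNamespace false

noncomputable section

open scoped MatrixGroups ModularForm Classical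

open CongruenceSubgroup WeierstrassCurve Literature.NumberTheory.EllipticCurves
  Literature.NumberTheory.EllipticCurves.ModularForms
  Literature.NumberTheory.EllipticCurves.Rank1Residual
  Literature.NumberTheory.EllipticCurves.Rank1Residual.Typed
  Literature.NumberTheory.EllipticCurves.Skinner2016
  Literature.NumberTheory.EllipticCurves.SteinWuthrich2013
  Literature.NumberTheory.Automorphic
  Summit.BirchSwinnertonDyer.BirchSwinnertonDyer.Theorems.Rank1ResidualX1Defs
open Literature.NumberTheory.DiophantineGeometry.Dioph (ratModP)

namespace Summit.BirchSwinnertonDyer.BirchSwinnertonDyer.Theorems.KimAtThreeDeepLowerOffStratumSemistable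

open Summit.BirchSwinnertonDyer.Rank1Residual
open Summit.BirchSwinnertonDyer.BirchSwinnertonDyer.Theses.KimAtThreeKolyvagin
open Summit.BirchSwinnertonDyer.BirchSwinnertonDyer.Theorems.KimAtThreeKolyvaginUnitLevelOneRungs
open Summit.BirchSwinnertonDyer.BirchSwinnertonDyer.Theorems.KimAtThreeDeepLowerSmallDefect
open Summit.BirchSwinnertonDyer.BirchSwinnertonDyer.Theorems.KimAtThreeDeepLowerNonAdditiveRows
open Summit.BirchSwinnertonDyer.BirchSwinnertonDyer.Theorems.KimAtThreeShallowEqDeepOffStratumSockets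
open Summit.BirchSwinnertonDyer.BirchSwinnertonDyer.Theorems.KimAtThreeShallowEqDeepOffStratumNonAdditiveRows
open Summit.BirchSwinnertonDyer.BirchSwinnertonDyer.Theorems.KimAtThreeDeepLowerOffStratumSockets
open Summit.BirchSwinnertonDyer.BirchSwinnertonDyer.Theorems.KimAtThreeDeepLowerOffStratumNonAdditiveRows
open Summit.BirchSwinnertonDyer.BirchSwinnertonDyer.Theorems.KimAtThreeDeepLowerTamagawaLevelLowering

/-! ### §1 Lower-half sockets on SEMISTABLE rows: no (ram) binder, no Yan–Zhu binder -/

section Sockets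

variable (W : WeierstrassCurve ℚ) [W.IsElliptic] [W.IsGloballyMinimal]

omit [W.IsElliptic] in
/-- On a semistable curve the reduction at `3` is good or multiplicative, so «ordinary if good» puts the
curve on row C1's reduction types. [folklore] -/
theorem goodOrd_or_mult_three_of_semistable (hsst : Semistable W)
    (hordinary : W.HasGoodReductionAtPrime 3 → ¬ (3 : ℤ) ∣ W.frobeniusTrace 3) :
    (W.HasGoodReductionAtPrime 3 ∧ ¬ (3 : ℤ) ∣ W.frobeniusTrace 3) ∨
      W.HasMultiplicativeReductionAtPrime 3 := by
  rcases hsst 3 Nat.prime_three with hg | hm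
  · exact Or.inl ⟨hg, hordinary hg⟩
  · exact Or.inr hm

/-- **SEMISTABLE, analytic rank `0`, `E[3]` irreducible, `3` not supersingular ⟹ `MissingLowerBoundAt W 3`
— no (ram) binder, flag-free.** Skinner 2016 Thm. C (`hSk`, good-ordinary-or-multiplicative with (ram),
`BSD(E,3)` in analytic rank `0`), modularity `hmod`, GZK; the (ram) witness is SUPPLIED by Ribet's
level-lowering to level one (`ram_three_of_semistable_of_irr`: Modularity `hBCDT` + Ribet 1990 / Diamond
1995 `hLL`), then gen 0's `missingLowerBoundAt_three_of_rowC1_of_skinner`. [cite: Skinner2016PacificMC, Thm. C (§1)]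
[cite: Ribet1990, Thm. 1.1] [cite: Diamond1995RefinedSerre, Thm. 1.1] [cite: Miller2011LMS, Def. 1.1] -/
theorem missingLowerBoundAt_three_of_semistable_of_skinner
    (hSk : Skinner2016.thmC_padicValRat_bsd_rank_zero)
    (hmod : hasEntireLFunction_rat) (hGZK : rank_eq_analyticRank_of_analyticRank_le_one)
    (hBCDT : exists_isNewformOf) (hLL : diamond1995_refinedSerre)
    (hr0 : W.analyticRank = 0) (hirr : W.HasIrreducibleModPGaloisRep 3) (hsst : Semistable W)
    (hordinary : W.HasGoodReductionAtPrime 3 → ¬ (3 : ℤ) ∣ W.frobeniusTrace 3) :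
    MissingLowerBoundAt W 3 :=
  haveI : Fact (Nat.Prime 3) := ⟨Nat.prime_three⟩
  missingLowerBoundAt_three_of_rowC1_of_skinner W hSk hmod hGZK hr0 hirr
    (goodOrd_or_mult_three_of_semistable W hsst hordinary)
    (ram_three_of_semistable_of_irr hBCDT hLL W hsst hirr)

/-- **The same socket from NUMBERED THEOREMS only** (main-conjecture level, no PUB* flag, no (ram)
binder): Skinner–Urban 2014 Thm. 3.6.9 (`hSU`), Skinner 2016 Thm. A (`hA`), Greenberg 1999 Thm. 4.1
(`hGr`), Stein–Wuthrich 2013 Thm. 6.1 (`hJs`, `hJn`), Greenberg–Stevens (`hGS`), Mazur 1978 Cor. 4.1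
(`hM`), modularity (`hmod`, `hpar`, `hBCDT`), GZK, Ribet/Diamond (`hLL`) — gen 0's
`missingLowerBoundAt_three_of_rowC1_of_mainConjectures_of_mazur` with its (ram) binder discharged on the
square-free conductors (Skinner–Urban's own remark before Cor. 3.6.10, at `p = 3`).
[cite: SkinnerUrban2014, Thm. 3.6.9 (p. 45), remark before Cor. 3.6.10 (p. 45)] [cite: Skinner2016PacificMC, Thm. A, §3.2–3.3]
[cite: GreenbergLNM1716, Thm. 4.1 (p. 102)] [cite: Mazur1978, Cor. 4.1] [cite: SteinWuthrich2013, Thm. 6.1 (p. 20)]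
[cite: Ribet1990, Thm. 1.1] [cite: Miller2011LMS, Def. 1.1] -/
theorem missingLowerBoundAt_three_of_semistable_of_mainConjectures_of_mazur
    (hSU : ∀ (W : WeierstrassCurve ℚ) [W.IsElliptic] [W.IsGloballyMinimal] (p : ℕ) [Fact p.Prime]
      (κ : ZpExtension ℚ p) (γ : Field.absoluteGaloisGroup ℚ) (N : ℕ) [NeZero N]
      (f : CuspForm (Gamma0 N) 2),
      skinner_urban_main_conjecture W p (κ := κ) (γ := γ) (f := f))
    (hA : thmA_charIdeal_multiplicative) (hGr : greenberg_charValue_rankZero)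
    (hJs : thm61_splitMultiplicative) (hJn : thm61_nonsplitMultiplicative)
    (hGS : ∀ (W : WeierstrassCurve ℚ) [W.IsElliptic] [W.IsGloballyMinimal] (p : ℕ) [Fact p.Prime],
      greenberg_stevens (W := W) (p := p))
    (hM : mazur_not_dvd_maninConstant_of_odd)
    (hmod : hasEntireLFunction_rat) (hpar : nonempty_modularParametrizationData)
    (hGZK : rank_eq_analyticRank_of_analyticRank_le_one)
    (hBCDT : exists_isNewformOf) (hLL : diamond1995_refinedSerre)
    (hr0 : W.analyticRank = 0) (hirr : W.HasIrreducibleModPGaloisRep 3) (hsst : Semistable W)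
    (hordinary : W.HasGoodReductionAtPrime 3 → ¬ (3 : ℤ) ∣ W.frobeniusTrace 3) :
    MissingLowerBoundAt W 3 :=
  haveI : Fact (Nat.Prime 3) := ⟨Nat.prime_three⟩
  missingLowerBoundAt_three_of_rowC1_of_mainConjectures_of_mazur W hSU hA hGr hJs hJn hGS hM hmod hpar hGZK
    hr0 hirr (goodOrd_or_mult_three_of_semistable W hsst hordinary)
    (ram_three_of_semistable_of_irr hBCDT hLL W hsst hirr)

omit [W.IsElliptic] [W.IsGloballyMinimal] in
/-- **On a semistable curve the row is never additive at `3`** (so the stub's binder `¬ Addv W₀ 3` is idle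
there): `Rank1Residual.not_addv_of_semistable`, restated with the stub's spelled-out instance. [folklore] -/
theorem not_addv_three_of_semistable (hsst : Semistable W) :
    ¬ (haveI : Fact (Nat.Prime 3) := ⟨Nat.prime_three⟩; Addv W 3) :=
  haveI : Fact (Nat.Prime 3) := ⟨Nat.prime_three⟩
  not_addv_of_semistable hsst 3

/-- **On a semistable curve a multiplicative `3` with `E[3]` irreducible always carries Skinner's (ram)
witness** — the multiplicative-`3`-WITHOUT-(ram) population of gen 0's residue is EMPTY on the square-free
conductors (`Rank1Residual.not_classX11a_three_of_semistable`, rmap-3 gen 4), restated in the row's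
vocabulary. [cite: Ribet1990, Thm. 1.1] [cite: Diamond1995RefinedSerre, Thm. 1.1] -/
theorem ram_three_of_semistable_of_towerSurj (hBCDT : exists_isNewformOf) (hLL : diamond1995_refinedSerre)
    (hsst : Semistable W) (htower : ∀ n : ℕ, W.HasSurjectiveModNGaloisRep (3 ^ n : ℕ)) :
    (haveI : Fact (Nat.Prime 3) := ⟨Nat.prime_three⟩; Ram W 3) :=
  haveI : Fact (Nat.Prime 3) := ⟨Nat.prime_three⟩
  ram_three_of_semistable_of_irr hBCDT hLL W hsst
    (hasIrreducibleModPGaloisRep_of_hasSurjectiveModNGaloisRep W 3 (by simpa using htower 1))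

end Sockets

/-! ### §2 The registered stub on its SEMISTABLE rows -/

section SemistableRows

/-- ★ **`stub_nonAdditive` on its SEMISTABLE rows from SIX named facts + TamDiv-deep, no (ram) and no
Yan–Zhu binder**: binders of the registered stub VERBATIM, then `Semistable W₀`, «ordinary if good» (the
supersingular `3` is the X6/X8 corner, no lower half in print) and (TD) `v₃(∏ c_ℓ) ≤ ∂^{(∞)}_{deep}(δ̃)`
asked only when `3 ∣ ∏ c_ℓ`. Inputs: Skinner 2016 Thm. C (`hSk`), modularity (`hmod`, `hBCDT`), GZK,
Mazur 1978 Cor. 4.1 (`hM`, the period transfer at the optimal datum), Ribet/Diamond level-lowering (`hLL`,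
the (ram) witness). [cite: Skinner2016PacificMC, Thm. C (§1)] [cite: Ribet1990, Thm. 1.1] [cite: Mazur1978, Cor. 4.1]
[cite: Kim2022StructureSelmer, Conj. 1.10 (PDF p. 8)] [cite: Miller2011LMS, Def. 1.1] -/
theorem stub_nonAdditive_semistable_of_skinner_of_tamagawa_le_deepInfty
    (hSk : Skinner2016.thmC_padicValRat_bsd_rank_zero)
    (hmod : hasEntireLFunction_rat) (hGZK : rank_eq_analyticRank_of_analyticRank_le_one)
    (hM : mazur_not_dvd_maninConstant_of_odd)
    (hBCDT : exists_isNewformOf) (hLL : diamond1995_refinedSerre) :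
    ∀ (W₀ : WeierstrassCurve ℚ) [W₀.IsElliptic] [W₀.IsGloballyMinimal],
      (∀ n : ℕ, W₀.HasSurjectiveModNGaloisRep (3 ^ n : ℕ)) → Finite W₀.sha →
      ∀ {N : ℕ} [NeZero N], N = W₀.conductorNorm ℤ →
      ∀ (D₀ : ModularParametrizationData W₀ N),
        (∀ z ∈ D₀.L.lattice, ∃ w ∈ periodLattice D₀.f, z = D₀.c * w) →
        (∀ (W₂ : WeierstrassCurve ℚ) [W₂.IsElliptic] (D₂ : ModularParametrizationData W₂ N),
          D₂.f = D₀.f → D₀.modularDegree ≤ D₂.modularDegree) →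
        (∀ r : ℚ, ratPlusSymbol D₀.f r ≠ 0 → 0 ≤ padicValRat 3 (ratPlusSymbol D₀.f r)) →
        kuriharaVanishingOrder W₀ 3 D₀.f = 0 →
        ¬ (haveI : Fact (Nat.Prime 3) := ⟨Nat.prime_three⟩; Addv W₀ 3) →
        -- the semistable rows, ordinary if good
        Semistable W₀ →
        (W₀.HasGoodReductionAtPrime 3 → ¬ (3 : ℤ) ∣ W₀.frobeniusTrace 3) →
        -- TamDiv-deep at the row, asked only when `3 ∣ ∏ c_ℓ`
        (3 ∣ W₀.tamagawaProduct →
          ((padicValNat 3 W₀.tamagawaProduct : ℕ) : ℕ∞) ≤ kuriharaPartialDeepInfty W₀ 3 D₀.f) →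
        ∃ d : ℕ, kuriharaPartialDeepInfty W₀ 3 D₀.f = d ∧
          kuriharaPartial W₀ 3 D₀.f 0 ≤
            ((padicValNat 3 (Nat.card (AddCommGroup.primaryComponent W₀.sha 3)) + d : ℕ) : ℕ∞) := by
  intro W₀ _ _ htower _ N _ hN D₀ hopt _ _ hord hnA hsst hordinary hTD
  haveI : Fact (Nat.Prime 3) := ⟨Nat.prime_three⟩
  have hf : IsNewformOf W₀ D₀.f := D₀.isNewformOf
  have hr0 : W₀.analyticRank = 0 := analyticRank_eq_zero_of_kuriharaVanishingOrder_eq_zero W₀ D₀.f hf hord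
  have hirr : W₀.HasIrreducibleModPGaloisRep 3 :=
    hasIrreducibleModPGaloisRep_of_hasSurjectiveModNGaloisRep W₀ 3 (by simpa using htower 1)
  have hper := periodTransfer_three_of_optimal_of_not_addv W₀ hM hN D₀ hopt hnA
  have hlow : MissingLowerBoundAt W₀ 3 :=
    missingLowerBoundAt_three_of_semistable_of_skinner W₀ hSk hmod hGZK hBCDT hLL hr0 hirr hsst hordinary
  by_cases htam : 3 ∣ W₀.tamagawaProduct
  · exact deepLower_conclusion_of_missingLowerBoundAt_of_tamagawa_le_deepInfty W₀ 3 D₀.f hGZK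
      (by norm_num) hirr hf hord hper hlow (hTD htam)
  · exact deepLower_conclusion_of_missingLowerBoundAt_of_not_dvd_tamagawa W₀ 3 D₀.f hGZK (by norm_num)
      hirr hf hord hper hlow htam

/-- ★ **`stub_nonAdditive` OUTRIGHT — named facts only — on the semistable rows with `3 ∤ ∏ c_ℓ`, ordinary
if good** (TamDiv-deep vacuous). [cite: Skinner2016PacificMC, Thm. C (§1)] [cite: Ribet1990, Thm. 1.1]
[cite: Mazur1978, Cor. 4.1] [cite: Miller2011LMS, Def. 1.1] -/
theorem stub_nonAdditive_semistable_of_skinner_of_not_three_dvd_tamagawa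
    (hSk : Skinner2016.thmC_padicValRat_bsd_rank_zero)
    (hmod : hasEntireLFunction_rat) (hGZK : rank_eq_analyticRank_of_analyticRank_le_one)
    (hM : mazur_not_dvd_maninConstant_of_odd)
    (hBCDT : exists_isNewformOf) (hLL : diamond1995_refinedSerre) :
    ∀ (W₀ : WeierstrassCurve ℚ) [W₀.IsElliptic] [W₀.IsGloballyMinimal],
      (∀ n : ℕ, W₀.HasSurjectiveModNGaloisRep (3 ^ n : ℕ)) → Finite W₀.sha →
      ∀ {N : ℕ} [NeZero N], N = W₀.conductorNorm ℤ →
      ∀ (D₀ : ModularParametrizationData W₀ N),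
        (∀ z ∈ D₀.L.lattice, ∃ w ∈ periodLattice D₀.f, z = D₀.c * w) →
        (∀ (W₂ : WeierstrassCurve ℚ) [W₂.IsElliptic] (D₂ : ModularParametrizationData W₂ N),
          D₂.f = D₀.f → D₀.modularDegree ≤ D₂.modularDegree) →
        (∀ r : ℚ, ratPlusSymbol D₀.f r ≠ 0 → 0 ≤ padicValRat 3 (ratPlusSymbol D₀.f r)) →
        kuriharaVanishingOrder W₀ 3 D₀.f = 0 →
        ¬ (haveI : Fact (Nat.Prime 3) := ⟨Nat.prime_three⟩; Addv W₀ 3) →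
        Semistable W₀ →
        (W₀.HasGoodReductionAtPrime 3 → ¬ (3 : ℤ) ∣ W₀.frobeniusTrace 3) →
        ¬ 3 ∣ W₀.tamagawaProduct →
        ∃ d : ℕ, kuriharaPartialDeepInfty W₀ 3 D₀.f = d ∧
          kuriharaPartial W₀ 3 D₀.f 0 ≤
            ((padicValNat 3 (Nat.card (AddCommGroup.primaryComponent W₀.sha 3)) + d : ℕ) : ℕ∞) := by
  intro W₀ _ _ htower hfin N _ hN D₀ hopt hdeg hint hord hnA hsst hordinary htam
  exact stub_nonAdditive_semistable_of_skinner_of_tamagawa_le_deepInfty hSk hmod hGZK hM hBCDT hLL W₀ htower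
    hfin hN D₀ hopt hdeg hint hord hnA hsst hordinary (fun h => absurd h htam)

/-- ★ **`stub_nonAdditive` on the semistable rows with `v₃(∏ c_ℓ) ≤ m` under the owner's stabilised
level-lowering congruence (LL_m)** — binders verbatim, then `Semistable W₀`, «ordinary if good»,
`v₃(∏ c_ℓ) ≤ m` and the congruence data `(q, u, φ)` of `KimAtThreeDeepLowerTamagawaLevelLowering` (displayed;
for `m = 1` and `q` a Tamagawa-`3` prime: Ribet 1990 on integral plus symbols + mod-`3` multiplicity one):
(TD) DISCHARGED by `tamagawa_le_kuriharaPartialInfty_of_stabilisedCongruence`; no (ram) binder.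
[cite: Skinner2016PacificMC, Thm. C (§1)] [cite: Ribet1990, Thm. 1.1] [cite: Mazur1978, Cor. 4.1]
[cite: Kim2025RefinedTNC, §8.1.2] [cite: Ota2018, Prop. 2.3 (1), Prop. 3.3] -/
theorem stub_nonAdditive_semistable_of_skinner_of_stabilisedCongruence
    (hSk : Skinner2016.thmC_padicValRat_bsd_rank_zero)
    (hmod : hasEntireLFunction_rat) (hGZK : rank_eq_analyticRank_of_analyticRank_le_one)
    (hM : mazur_not_dvd_maninConstant_of_odd)
    (hBCDT : exists_isNewformOf) (hLL : diamond1995_refinedSerre) :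
    ∀ (W₀ : WeierstrassCurve ℚ) [W₀.IsElliptic] [W₀.IsGloballyMinimal],
      (∀ n : ℕ, W₀.HasSurjectiveModNGaloisRep (3 ^ n : ℕ)) → Finite W₀.sha →
      ∀ {N : ℕ} [NeZero N], N = W₀.conductorNorm ℤ →
      ∀ (D₀ : ModularParametrizationData W₀ N),
        (∀ z ∈ D₀.L.lattice, ∃ w ∈ periodLattice D₀.f, z = D₀.c * w) →
        (∀ (W₂ : WeierstrassCurve ℚ) [W₂.IsElliptic] (D₂ : ModularParametrizationData W₂ N),
          D₂.f = D₀.f → D₀.modularDegree ≤ D₂.modularDegree) →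
        (∀ r : ℚ, ratPlusSymbol D₀.f r ≠ 0 → 0 ≤ padicValRat 3 (ratPlusSymbol D₀.f r)) →
        kuriharaVanishingOrder W₀ 3 D₀.f = 0 →
        ¬ (haveI : Fact (Nat.Prime 3) := ⟨Nat.prime_three⟩; Addv W₀ 3) →
        Semistable W₀ →
        (W₀.HasGoodReductionAtPrime 3 → ¬ (3 : ℤ) ∣ W₀.frobeniusTrace 3) →
        ∀ m : ℕ, padicValNat 3 W₀.tamagawaProduct ≤ m →
        ∀ (q : ℕ), q ∣ W₀.conductorNorm ℤ * 3 → ∀ (u : ZMod (3 ^ m)) (φ : ℚ → ZMod (3 ^ m)),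
          (∀ x, φ (x + 1) = φ x) →
          (∀ ℓ : ℕ, ℓ.Prime → ¬ ℓ ∣ W₀.conductorNorm ℤ * 3 → ∀ x : ℚ,
            (W₀.frobeniusTrace ℓ : ZMod (3 ^ m)) * φ x = (∑ j : Fin ℓ, φ ((x + j) / ℓ)) + φ (ℓ * x)) →
          (∀ x : ℚ, ratModP (3 ^ m) (ratPlusSymbol D₀.f x) = u * (φ x - φ (q * x))) →
        ∃ d : ℕ, kuriharaPartialDeepInfty W₀ 3 D₀.f = d ∧
          kuriharaPartial W₀ 3 D₀.f 0 ≤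
            ((padicValNat 3 (Nat.card (AddCommGroup.primaryComponent W₀.sha 3)) + d : ℕ) : ℕ∞) := by
  intro W₀ _ _ htower hfin N _ hN D₀ hopt hdeg hint hord hnA hsst hordinary m hv q hq u φ hperφ hφH hC
  haveI : Fact (Nat.Prime 3) := ⟨Nat.prime_three⟩
  exact stub_nonAdditive_semistable_of_skinner_of_tamagawa_le_deepInfty hSk hmod hGZK hM hBCDT hLL W₀ htower
    hfin hN D₀ hopt hdeg hint hord hnA hsst hordinary (fun _ =>
      (tamagawa_le_kuriharaPartialInfty_of_stabilisedCongruence W₀ 3 m D₀.f hint hv q hq u φ hperφ hφH hC).2)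

end SemistableRows

/-! ### §3 Necessity on the semistable rows -/

section Necessity

/-- **Necessity is unchanged: on the semistable rows the stub's row conclusion still IMPLIES (TD)** —
`BSD(E,3)` by name (Skinner 2016 Thm. C with (ram) automatic; Wuthrich's Prop. 21 is not even needed) gives
Miller's upper half, then gen 0's `tamagawa_le_deepInfty_of_lowerRow_of_missingUpperBoundAt`. So on the
semistable non-supersingular rows `stub_nonAdditive` is EQUIVALENT (modulo print) to (TD).
[cite: Skinner2016PacificMC, Thm. C (§1)] [cite: Ribet1990, Thm. 1.1] [cite: Kim2022StructureSelmer, Conj. 1.10 (PDF p. 8)] -/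
theorem tamagawa_le_deepInfty_of_stubRow_semistable
    (hSk : Skinner2016.thmC_padicValRat_bsd_rank_zero)
    (hmod : hasEntireLFunction_rat) (hGZK : rank_eq_analyticRank_of_analyticRank_le_one)
    (hM : mazur_not_dvd_maninConstant_of_odd)
    (hBCDT : exists_isNewformOf) (hLL : diamond1995_refinedSerre)
    (W₀ : WeierstrassCurve ℚ) [W₀.IsElliptic] [W₀.IsGloballyMinimal]
    (htower : ∀ n : ℕ, W₀.HasSurjectiveModNGaloisRep (3 ^ n : ℕ))
    {N : ℕ} [NeZero N] (hN : N = W₀.conductorNorm ℤ) (D₀ : ModularParametrizationData W₀ N)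
    (hopt : ∀ z ∈ D₀.L.lattice, ∃ w ∈ periodLattice D₀.f, z = D₀.c * w)
    (hord : kuriharaVanishingOrder W₀ 3 D₀.f = 0)
    (hsst : Semistable W₀)
    (hordinary : W₀.HasGoodReductionAtPrime 3 → ¬ (3 : ℤ) ∣ W₀.frobeniusTrace 3)
    (hrow : ∃ d : ℕ, kuriharaPartialDeepInfty W₀ 3 D₀.f = d ∧
      kuriharaPartial W₀ 3 D₀.f 0 ≤
        ((padicValNat 3 (Nat.card (AddCommGroup.primaryComponent W₀.sha 3)) + d : ℕ) : ℕ∞)) :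
    ((padicValNat 3 W₀.tamagawaProduct : ℕ) : ℕ∞) ≤ kuriharaPartialDeepInfty W₀ 3 D₀.f := by
  haveI : Fact (Nat.Prime 3) := ⟨Nat.prime_three⟩
  have hf : IsNewformOf W₀ D₀.f := D₀.isNewformOf
  have hr0 : W₀.analyticRank = 0 := analyticRank_eq_zero_of_kuriharaVanishingOrder_eq_zero W₀ D₀.f hf hord
  have hirr : W₀.HasIrreducibleModPGaloisRep 3 :=
    hasIrreducibleModPGaloisRep_of_hasSurjectiveModNGaloisRep W₀ 3 (by simpa using htower 1)
  have hnA := not_addv_three_of_semistable W₀ hsst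
  have hper := periodTransfer_three_of_optimal_of_not_addv W₀ hM hN D₀ hopt hnA
  have hC1 : RowC1 W₀ 3 :=
    ⟨hr0, le_rfl, by
      rcases goodOrd_or_mult_three_of_semistable W₀ hsst hordinary with ⟨hg, ho⟩ | hm
      · exact Or.inl ⟨hg, by exact_mod_cast ho⟩
      · exact Or.inr hm, hirr, ram_three_of_semistable_of_irr hBCDT hLL W₀ hsst hirr⟩
  haveI : Finite W₀.sha := (hGZK W₀ (by rw [hr0]; exact zero_le_one)).2
  have hbsd : BSDp W₀ 3 := RowC1.bsdp hSk hmod hGZK hC1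
  exact (deepLower_conclusion_three_iff_tamagawa_le_deepInfty_of_bsdp W₀ D₀.f hGZK htower
    (hGZK W₀ (by rw [hr0]; exact zero_le_one)).2 hf hord hper hbsd).mp hrow

end Necessity

end Summit.BirchSwinnertonDyer.BirchSwinnertonDyer.Theorems.KimAtThreeDeepLowerOffStratumSemistable

end
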